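import Summits.MatrixMultiplication.MatrixMultiplication.Theses.ThinBlockAlpha

/-!
# `BoundedExponentThird` (crux stmt-MatrixMultiplication-10596, route ThinBlockAlpha):
# the two-leg translation mechanism and the first refuted strengthenings

Negative-side support file of the crux disprover (cdisprove seat); everything `sorry`-free.
The crux asks for STPP families with thin blocks `⟨N, M, N⟩`, `M ≥ N^{1/3}`, in abelian groups of
bounded exponent whose two long legs pack tightly: `|H| ≤ L·N^{2+η}` for every `η > 0`.

* §1 `translate_not_mem`, `two_leg_bound` — for an STPP family the leg sets `U i = C i − A i` are
  disjoint of full size and every translate `U i + d`, `d ∈ (B i − B i) ∖ {0}`, avoids ALL `U j`;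
  hence `(L + M − 1)·N² ≤ |H|` (exact two-leg tightness forces `M ≤ 1`).
* §2 `DesignAt ℓ η` (one slack level; `boundedExponentThird_iff`), `blocks_forced`
  (`M − 1 ≤ L (N^η − 1)`), `not_designAt_zero` — the `η = 0` endpoint is false for every `ℓ`.
* §3 `card_mul_le_of_common_middle` — a common middle sub-pattern `B₀` costs its full size:
  `(Σ|A i||C i|)·|B₀| ≤ |H|`; `not_BoundedExponentThirdTranslateB` — the strengthening with
  translate-coherent middle sets is false (such designs certify only `ω(1,a,1) ≤ 2 + a`).
* Sibling files: `CoherentFamilies.lean` (coherent leg sets / ONE translate-coherent outer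
  family certify nothing either), `BlocksGrow.lean` (in bounded exponent the witness blocks
  must grow, via the tree's Thm A).

Details, the heuristic picture and compute calibrations: `Cruxes/BoundedExponentThird/Disproof.lean`.
-/

namespace Summit.MatrixMultiplication.MatrixMultiplication.Theorems.BoundedExponentThird.Negative

open Finset Literature.Computability.AlgebraicComplexity
open Summit.MatrixMultiplication.MatrixMultiplication.Theses.ThinBlockAlpha (BoundedExponentThird)

section Mechanism

variable {H : Type*} [AddCommGroup H] {L : ℕ} {A B C : Fin L → Finset H}

/-- **Translation mechanism.** In an STPP family, for `a ∈ A i`, `c ∈ C i` and two DISTINCT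
middle elements `b ≠ b'` of the same block, the translate `(c − a) + (b' − b)` is never of the form
`c' − a'` with `a' ∈ A j`, `c' ∈ C j` — for ANY block `j`, including `j = i`.
(STPP instance `(i, i, j)` of the tree's one-clause `IsSTPP`.) -/
theorem translate_not_mem (h : IsSTPP A B C) {i j : Fin L} {a c b b' a' c' : H}
    (ha : a ∈ A i) (hc : c ∈ C i) (hb : b ∈ B i) (hb' : b' ∈ B i) (hbb' : b ≠ b')
    (ha' : a' ∈ A j) (hc' : c' ∈ C j) : (c - a) + (b' - b) ≠ c' - a' := by
  intro he
  have e1 : (c - a) + (b' - b) - (c' - a') = 0 := sub_eq_zero.mpr he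
  have e2 : (a - a') + (b - b') + (c' - c) = -((c - a) + (b' - b) - (c' - a')) := by abel
  have key := h i i j a' ha' a ha b' hb' b hb c hc c' hc' (by rw [e2, e1, neg_zero])
  exact hbb' key.2.2.2.1.symm

/-- `(a, c) ↦ c − a` is injective on a block (the TPP part; needs `B i` nonempty). -/
theorem sub_injOn (h : IsSTPP A B C) {i : Fin L} (hB : (B i).Nonempty) :
    Set.InjOn (fun p : H × H => p.2 - p.1) ↑((A i) ×ˢ (C i)) := by
  rintro ⟨a, c⟩ hp ⟨a', c'⟩ hp' (he : c - a = c' - a')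
  simp only [coe_product, Set.mem_prod, mem_coe] at hp hp'
  obtain ⟨b, hb⟩ := hB
  have e2 : (a' - a) + (b - b) + (c - c') = (c - a) - (c' - a') := by abel
  have key := h i i i a hp.1 a' hp'.1 b hb b hb c' hp'.2 c hp.2 (by rw [e2, he, sub_self])
  exact Prod.ext key.2.2.1 key.2.2.2.2.symm

variable [DecidableEq H]

/-- The leg set `U i = C i − A i` of block `i`. -/
def legSet (A C : Fin L → Finset H) (i : Fin L) : Finset H :=
  ((A i) ×ˢ (C i)).image fun p => p.2 - p.1

/-- The two-leg packed set `W = ⋃ᵢ (C i − A i)`. -/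
def packedSet (A C : Fin L → Finset H) : Finset H := Finset.univ.biUnion (legSet A C)

/-- Membership in a leg set. -/
theorem mem_legSet {A C : Fin L → Finset H} {i : Fin L} {x : H} :
    x ∈ legSet A C i ↔ ∃ a ∈ A i, ∃ c ∈ C i, c - a = x := by
  simp only [legSet, mem_image, mem_product, Prod.exists]
  constructor
  · rintro ⟨a, c, ⟨ha, hc⟩, rfl⟩; exact ⟨a, ha, c, hc, rfl⟩
  · rintro ⟨a, ha, c, hc, rfl⟩; exact ⟨a, c, ⟨ha, hc⟩, rfl⟩

/-- A leg set has full size `|A i|·|C i|` (TPP injectivity). -/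
theorem card_legSet (h : IsSTPP A B C) {i : Fin L} (hB : (B i).Nonempty) :
    (legSet A C i).card = (A i).card * (C i).card := by
  rw [legSet, card_image_of_injOn (sub_injOn h hB), card_product]

/-- Leg sets of distinct blocks are disjoint (STPP instance `(j, j, i)`). -/
theorem disjoint_legSet (h : IsSTPP A B C) (hB : ∀ i, (B i).Nonempty) {i j : Fin L} (hij : i ≠ j) :
    Disjoint (legSet A C i) (legSet A C j) := by
  rw [Finset.disjoint_left]
  intro x hx hx'
  obtain ⟨a, ha, c, hc, rfl⟩ := mem_legSet.1 hx
  obtain ⟨a', ha', c', hc', he⟩ := mem_legSet.1 hx'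
  obtain ⟨b, hb⟩ := hB j
  have e2 : (a' - a) + (b - b) + (c - c') = (c - a) - (c' - a') := by abel
  have key := h j j i a ha a' ha' b hb b hb c' hc' c hc (by rw [e2, he, sub_self])
  exact hij key.2.1.symm

/-- The packed set has size `Σᵢ |A i||C i|`. -/
theorem card_packedSet (h : IsSTPP A B C) (hB : ∀ i, (B i).Nonempty) :
    (packedSet A C).card = ∑ i, (A i).card * (C i).card := by
  rw [packedSet, card_biUnion (fun i _ j _ hij => disjoint_legSet h hB hij)]
  exact Finset.sum_congr rfl fun i _ => card_legSet h (hB i)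

/-- The translates of block `i₀` by the nonzero differences `b − b₀`, `b ∈ B i₀ ∖ {b₀}`. -/
def translateSet (A B C : Fin L → Finset H) (i₀ : Fin L) (b₀ : H) : Finset H :=
  (((B i₀).erase b₀) ×ˢ ((A i₀) ×ˢ (C i₀))).image fun q => (q.2.2 - q.2.1) + (q.1 - b₀)

/-- The translate set of block `i₀` has size `(|B i₀| − 1)·|A i₀|·|C i₀|` (TPP injectivity). -/
theorem card_translateSet (h : IsSTPP A B C) {i₀ : Fin L} {b₀ : H} (hb₀ : b₀ ∈ B i₀) :
    (translateSet A B C i₀ b₀).card = ((B i₀).card - 1) * ((A i₀).card * (C i₀).card) := by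
  rw [translateSet, card_image_of_injOn, card_product, card_product, card_erase_of_mem hb₀]
  rintro ⟨b, a, c⟩ hq ⟨b', a', c'⟩ hq' (he : (c - a) + (b - b₀) = (c' - a') + (b' - b₀))
  simp only [coe_product, Set.mem_prod, mem_coe, mem_erase] at hq hq'
  have e2 : (a' - a) + (b - b') + (c - c') = ((c - a) + (b - b₀)) - ((c' - a') + (b' - b₀)) := by
    abel
  have key := h i₀ i₀ i₀ a hq.2.1 a' hq'.2.1 b' hq'.1.2 b hq.1.2 c' hq'.2.2 c hq.2.2
    (by rw [e2, he, sub_self])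
  obtain ⟨-, -, h1, h2, h3⟩ := key
  exact Prod.ext h2.symm (Prod.ext h1 h3.symm)

/-- The translates avoid the packed set (the translation mechanism). -/
theorem disjoint_packedSet_translateSet (h : IsSTPP A B C) {i₀ : Fin L} {b₀ : H} (hb₀ : b₀ ∈ B i₀) :
    Disjoint (packedSet A C) (translateSet A B C i₀ b₀) := by
  rw [Finset.disjoint_right]
  intro x hx hx'
  simp only [translateSet, mem_image, mem_product, mem_erase, Prod.exists] at hx
  obtain ⟨b, a, c, ⟨⟨hbb, hb⟩, ha, hc⟩, rfl⟩ := hx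
  simp only [packedSet, mem_biUnion, mem_univ, true_and] at hx'
  obtain ⟨j, hj⟩ := hx'
  obtain ⟨a', ha', c', hc', he⟩ := mem_legSet.1 hj
  exact translate_not_mem h ha hc hb₀ hb (Ne.symm hbb) ha' hc' he.symm

/-- **Two-leg bound with the middle-leg correction.** For an STPP family in a finite abelian group,
any block `i₀` and any `b₀ ∈ B i₀`:
`∑ᵢ |A i||C i| + (|B i₀| − 1)·|A i₀||C i₀| ≤ |H|`. -/
theorem card_union_ge [Fintype H] (h : IsSTPP A B C) (hB : ∀ i, (B i).Nonempty) {i₀ : Fin L} {b₀ : H}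
    (hb₀ : b₀ ∈ B i₀) :
    ∑ i, (A i).card * (C i).card + ((B i₀).card - 1) * ((A i₀).card * (C i₀).card) ≤
      Fintype.card H := by
  rw [← card_packedSet h hB, ← card_translateSet h hb₀,
    ← card_union_of_disjoint (disjoint_packedSet_translateSet h hb₀)]
  exact card_le_univ _

/-- **Two-leg bound, uniform blocks `⟨N, M, N⟩`:** `(L + (M − 1)) · N² ≤ |H|` as soon as `M ≥ 1`
and the family is nonempty.  Exact two-leg tightness `|H| = L·N²` therefore forces `M ≤ 1`:
the `a = 0` coset tilings are the ONLY exactly tight designs. -/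
theorem two_leg_bound [Fintype H] (h : IsSTPP A B C) {N M : ℕ} (hA : ∀ i, (A i).card = N)
    (hBc : ∀ i, (B i).card = M) (hC : ∀ i, (C i).card = N) (hM : 1 ≤ M) (i₀ : Fin L) :
    (L + (M - 1)) * (N * N) ≤ Fintype.card H := by
  have hB : ∀ i, (B i).Nonempty := fun i => card_pos.1 (by rw [hBc i]; exact hM)
  obtain ⟨b₀, hb₀⟩ := hB i₀
  have := card_union_ge h hB hb₀
  simp only [hA, hC, hBc, sum_const, card_univ, Fintype.card_fin, smul_eq_mul] at this
  linarith [this, Nat.add_mul L (M - 1) (N * N)]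

end Mechanism

/-! ## §2  The crux, one slack level at a time; the `η = 0` endpoint is false -/

section SlackLevels

/-- One slack level of the crux: an exponent-`≤ ℓ` abelian design of blocks `⟨N, M, N⟩`, `N ≥ 2`,
`M ≥ N^{1/3}`, with two-leg slack `N^η`.  `BoundedExponentThird ↔ ∃ ℓ, ∀ η > 0, DesignAt ℓ η`
(`boundedExponentThird_iff`, by `Iff.rfl`). -/
def DesignAt (ℓ : ℕ) (η : ℝ) : Prop :=
  ∃ (H : Type) (_ : AddCommGroup H) (_ : Fintype H) (L N M : ℕ) (A B C : Fin L → Finset H),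
    AddMonoid.exponent H ≤ ℓ ∧ IsSTPP A B C ∧
    (∀ i, (A i).card = N ∧ (B i).card = M ∧ (C i).card = N) ∧ 2 ≤ N ∧
    (N : ℝ) ^ (1 / 3 : ℝ) ≤ M ∧ (Fintype.card H : ℝ) ≤ L * (N : ℝ) ^ (2 + η)

/-- The crux, one slack level at a time. -/
theorem boundedExponentThird_iff : BoundedExponentThird ↔ ∃ ℓ, ∀ η : ℝ, 0 < η → DesignAt ℓ η :=
  Iff.rfl

/-- Slack levels are monotone: more slack is easier. -/
theorem DesignAt.mono {ℓ : ℕ} {η η' : ℝ} (h : DesignAt ℓ η) (hle : η ≤ η') : DesignAt ℓ η' := by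
  obtain ⟨H, i1, i2, L, N, M, A, B, C, hexp, hS, hc, hN, hM, hH⟩ := h
  refine ⟨H, i1, i2, L, N, M, A, B, C, hexp, hS, hc, hN, hM, hH.trans ?_⟩
  have hN1 : (1 : ℝ) ≤ N := by exact_mod_cast (by omega : 1 ≤ N)
  exact mul_le_mul_of_nonneg_left (Real.rpow_le_rpow_of_exponent_le hN1 (by linarith))
    (Nat.cast_nonneg _)

/-- Bookkeeping shared by all levels: `N ≥ 2` and `N^{1/3} ≤ M` force `M ≥ 2`. -/
theorem two_le_middle {N M : ℕ} (hN : 2 ≤ N) (hM : (N : ℝ) ^ (1 / 3 : ℝ) ≤ M) : 2 ≤ M := by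
  have h1 : (1 : ℝ) < (N : ℝ) ^ (1 / 3 : ℝ) :=
    Real.one_lt_rpow (by exact_mod_cast (by omega : 1 < N)) (by norm_num)
  have : (1 : ℝ) < M := h1.trans_le hM
  exact_mod_cast this

/-- Bookkeeping: the packing inequality forces a nonempty family (`|H| ≥ 1`). -/
theorem blocks_pos {H : Type*} [Fintype H] [Nonempty H] {L N : ℕ} {η : ℝ}
    (hH : (Fintype.card H : ℝ) ≤ L * (N : ℝ) ^ (2 + η)) : 0 < L := by
  rcases Nat.eq_zero_or_pos L with rfl | hL
  · have : (0 : ℝ) < Fintype.card H := by exact_mod_cast Fintype.card_pos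
    simp only [Nat.cast_zero, zero_mul] at hH
    linarith
  · exact hL

/-- **Any witness at slack `η` has many blocks:** `M − 1 ≤ L · (N^η − 1)` (from `two_leg_bound`).
In particular `L → ∞` as `η → 0` at fixed `N`, and `L ≥ (N^{1/3} − 1)/(N^η − 1)`. -/
theorem blocks_forced {H : Type*} [AddCommGroup H] [Fintype H] [DecidableEq H] {L : ℕ}
    {A B C : Fin L → Finset H} (h : IsSTPP A B C) {N M : ℕ} (hA : ∀ i, (A i).card = N)
    (hBc : ∀ i, (B i).card = M) (hC : ∀ i, (C i).card = N) (hM : 1 ≤ M) (hN : 1 ≤ N) {η : ℝ}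
    (hH : (Fintype.card H : ℝ) ≤ L * (N : ℝ) ^ (2 + η)) :
    ((M : ℝ) - 1) ≤ L * ((N : ℝ) ^ η - 1) := by
  have hL : 0 < L := blocks_pos hH
  have key := two_leg_bound h hA hBc hC hM ⟨0, hL⟩
  have hNpos : (0 : ℝ) < N := by exact_mod_cast hN
  have hN2 : (0 : ℝ) < (N : ℝ) * N := mul_pos hNpos hNpos
  have e1 : (N : ℝ) ^ (2 + η) = (N : ℝ) * N * (N : ℝ) ^ η := by
    rw [Real.rpow_add hNpos, Real.rpow_two, sq]
  have key' : ((L : ℝ) + ((M : ℝ) - 1)) * ((N : ℝ) * N) ≤ L * ((N : ℝ) * N * (N : ℝ) ^ η) := by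
    have := (Nat.cast_le (α := ℝ)).2 key
    push_cast [Nat.cast_sub hM] at this
    rw [← e1]; exact this.trans hH
  have : ((L : ℝ) + ((M : ℝ) - 1)) ≤ L * (N : ℝ) ^ η := by
    rw [show (L : ℝ) * ((N : ℝ) * N * (N : ℝ) ^ η) = (L * (N : ℝ) ^ η) * ((N : ℝ) * N) by ring]
      at key'
    exact le_of_mul_le_mul_right key' hN2
  linarith

/-- **The `η = 0` endpoint of the crux is false, for every exponent bound `ℓ`** (natural
strengthening refuted): exact two-leg tightness `|H| ≤ L N²` with `M ≥ N^{1/3}`, `N ≥ 2` is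
impossible in any finite abelian group — by `two_leg_bound`, `(L + M − 1) N² ≤ |H| ≤ L N²` forces
`M ≤ 1`.  So the crux is purely asymptotic (`η → 0⁺`); no finite design is "the" witness. -/
theorem not_designAt_zero (ℓ : ℕ) : ¬ DesignAt ℓ 0 := by
  rintro ⟨H, i1, i2, L, N, M, A, B, C, -, hS, hc, hN, hM, hH⟩
  classical
  have hM2 : 2 ≤ M := two_le_middle hN hM
  have := blocks_forced hS (fun i => (hc i).1) (fun i => (hc i).2.1) (fun i => (hc i).2.2)
    (by omega) (by omega) hH
  simp only [Real.rpow_zero, sub_self, mul_zero] at this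
  have : (2 : ℝ) ≤ M := by exact_mod_cast hM2
  linarith

end SlackLevels

/-! ## §3  Coherent middle sets certify nothing -/

section CommonMiddle

variable {H : Type*} [AddCommGroup H] [Fintype H] [DecidableEq H] {L : ℕ} {A B C : Fin L → Finset H}

/-- **Common middle pattern costs its full size.** If every middle set `B i` contains a translate
of one set `B₀`, then `W + B₀` is a direct sum: `(∑ᵢ |A i||C i|) · |B₀| ≤ |H|`.
(For `|B₀| = M` this is the trivial volume bound `L N² M ≤ |H|` of a single block, now for the
whole family: such designs certify only `ω(1,a,1) ≤ 2 + a`.) -/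
theorem card_mul_le_of_common_middle (h : IsSTPP A B C) (B₀ : Finset H)
    (hB₀ : ∀ i, ∃ x : H, B₀.image (· + x) ⊆ B i) :
    (∑ i, (A i).card * (C i).card) * B₀.card ≤ Fintype.card H := by
  rcases B₀.eq_empty_or_nonempty with rfl | hne
  · simp
  have hB : ∀ i, (B i).Nonempty := fun i => by
    obtain ⟨x, hx⟩ := hB₀ i
    obtain ⟨b, hb⟩ := hne
    exact ⟨b + x, hx (mem_image_of_mem _ hb)⟩
  rw [← card_packedSet h hB, ← card_product]
  refine le_trans (card_le_card_of_injOn (fun p => p.1 + p.2) (fun _ _ => mem_univ _) ?_)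
    (card_univ (α := H)).le
  rintro ⟨w, b⟩ hp ⟨w', b'⟩ hp' (he : w + b = w' + b')
  simp only [coe_product, Set.mem_prod, mem_coe, packedSet, mem_biUnion, mem_univ,
    true_and] at hp hp'
  obtain ⟨⟨i, hi⟩, hb⟩ := hp
  obtain ⟨⟨j, hj⟩, hb'⟩ := hp'
  obtain ⟨a, ha, c, hc, rfl⟩ := mem_legSet.1 hi
  obtain ⟨a', ha', c', hc', rfl⟩ := mem_legSet.1 hj
  by_cases hbb : b = b'
  · subst hbb
    exact Prod.ext (add_right_cancel he) rfl
  · exfalso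
    obtain ⟨x, hx⟩ := hB₀ i
    have hβ : b + x ∈ B i := hx (mem_image_of_mem _ hb)
    have hβ' : b' + x ∈ B i := hx (mem_image_of_mem _ hb')
    refine translate_not_mem h ha hc hβ' hβ (fun e => hbb (add_right_cancel e).symm) ha' hc' ?_
    rw [show (b + x) - (b' + x) = b - b' by abel, ← sub_eq_zero, ← sub_eq_zero.2 he]
    abel

/-- Arithmetic core of the "certify nothing" refutations: a family with the full middle
factor in its volume bound, `L N² M ≤ |H|`, cannot have two-leg slack `N^{1/6}` when
`M ≥ N^{1/3}`, `N ≥ 2`. -/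
theorem false_of_volume_bound {H : Type*} [Fintype H] {L N M : ℕ} (hL : 0 < L) (hN : 2 ≤ N)
    (hM : (N : ℝ) ^ (1 / 3 : ℝ) ≤ M) (hvol : L * (N * N) * M ≤ Fintype.card H)
    (hH : (Fintype.card H : ℝ) ≤ L * (N : ℝ) ^ (2 + 1 / 6 : ℝ)) : False := by
  have hNpos : (0 : ℝ) < N := by exact_mod_cast (by omega : 0 < N)
  have hN1 : (1 : ℝ) < N := by exact_mod_cast (by omega : 1 < N)
  have hLpos : (0 : ℝ) < L := by exact_mod_cast hL
  have e1 : (N : ℝ) ^ (2 + 1 / 6 : ℝ) = (N : ℝ) * N * (N : ℝ) ^ (1 / 6 : ℝ) := by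
    rw [Real.rpow_add hNpos, Real.rpow_two, sq]
  have key' : (L : ℝ) * (N * N) * M ≤ L * ((N : ℝ) * N * (N : ℝ) ^ (1 / 6 : ℝ)) := by
    have := (Nat.cast_le (α := ℝ)).2 hvol
    push_cast at this
    rw [← e1]; exact this.trans hH
  have hM6 : (M : ℝ) ≤ (N : ℝ) ^ (1 / 6 : ℝ) := by
    have h2 : (0 : ℝ) < (L : ℝ) * (N * N) := by positivity
    rw [show (L : ℝ) * ((N : ℝ) * N * (N : ℝ) ^ (1 / 6 : ℝ)) =
      (L : ℝ) * (N * N) * (N : ℝ) ^ (1 / 6 : ℝ) by ring] at key'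
    exact le_of_mul_le_mul_left key' h2
  have h6 : (1 : ℝ) < (N : ℝ) ^ (1 / 6 : ℝ) := Real.one_lt_rpow hN1 (by norm_num)
  have e3 : (N : ℝ) ^ (1 / 3 : ℝ) = (N : ℝ) ^ (1 / 6 : ℝ) * (N : ℝ) ^ (1 / 6 : ℝ) := by
    rw [← Real.rpow_add hNpos]; norm_num
  have : (N : ℝ) ^ (1 / 6 : ℝ) < (N : ℝ) ^ (1 / 3 : ℝ) := by
    rw [e3]; exact lt_mul_left (by linarith) h6
  linarith

/-- NATURAL STRENGTHENING: the crux with all middle sets translates of ONE pattern `B₀`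
(covers single-block designs `L = 1`, coset/product designs with a fixed middle factor, and the
CKSU `Cyc_n³` two-block example's shape). -/
def BoundedExponentThirdTranslateB : Prop :=
  ∃ ℓ : ℕ, ∀ η : ℝ, 0 < η → ∃ (H : Type) (_ : AddCommGroup H) (_ : Fintype H) (L N M : ℕ)
    (A B C : Fin L → Finset H) (B₀ : Finset H) (x : Fin L → H),
    (∀ i, B i = B₀.map (addRightEmbedding (x i))) ∧ AddMonoid.exponent H ≤ ℓ ∧ IsSTPP A B C ∧
    (∀ i, (A i).card = N ∧ (B i).card = M ∧ (C i).card = N) ∧ 2 ≤ N ∧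
    (N : ℝ) ^ (1 / 3 : ℝ) ≤ M ∧ (Fintype.card H : ℝ) ≤ L * (N : ℝ) ^ (2 + η)

/-- It is a strengthening of the crux. -/
theorem translateB_imp : BoundedExponentThirdTranslateB → BoundedExponentThird := by
  rintro ⟨ℓ, h⟩
  refine ⟨ℓ, fun η hη => ?_⟩
  obtain ⟨H, i1, i2, L, N, M, A, B, C, -, -, -, rest⟩ := h η hη
  exact ⟨H, i1, i2, L, N, M, A, B, C, rest⟩

/-- **Refuted strengthening:** translate-coherent middle sets give `L N² M ≤ |H| ≤ L N^{2+η}`,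
i.e. `M ≤ N^η`, incompatible with `M ≥ N^{1/3}` once `η < 1/3`.  ANY witness of the crux must use
middle sets that are not translates of a common pattern (more: no common sub-pattern of size
`> N^η`, by `card_mul_le_of_common_middle`). -/
theorem not_BoundedExponentThirdTranslateB : ¬ BoundedExponentThirdTranslateB := by
  rintro ⟨ℓ, h⟩
  obtain ⟨H, i1, i2, L, N, M, A, B, C, B₀, x, hBx, -, hS, hc, hN, hM, hH⟩ :=
    h (1 / 6) (by norm_num)
  classical
  have hL : 0 < L := blocks_pos hH
  have hB₀c : B₀.card = M := by
    rw [← (hc ⟨0, hL⟩).2.1, hBx, card_map]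
  have key := card_mul_le_of_common_middle hS B₀ (fun i => ⟨x i, by
    rw [hBx i, map_eq_image]; exact subset_rfl⟩)
  simp only [hc, sum_const, card_univ, Fintype.card_fin, smul_eq_mul, hB₀c] at key
  exact false_of_volume_bound hL hN hM key hH

end CommonMiddle

end Summit.MatrixMultiplication.MatrixMultiplication.Theorems.BoundedExponentThird.Negative
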